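import Summits.RiemannHypothesis.RiemannHypothesis.Theorems.WeilGroundStateGroundStatesConvergeToXiStubMellinDivide
import Literature.NumberTheory.LFunctions.RiemannXiFourier
import Mathlib.Analysis.SpecialFunctions.ImproperIntegrals
import Mathlib.MeasureTheory.Integral.IntegralEqImproper
import HarnessLib

/-!
# HANDOFF — the rate-`π` Gaussian tail class: Riemann's kernel and its Mellin quotients (file XX-a)

Cell `rh-explicit`, TRACK «HANDOFF» (ROUTE 1′), seat theory-1 (H-T, statement owner), gen18. Pure
analysis, RH-free, Mathlib + two tree files (`RiemannXiFourier`: the theta series `S_p`, `Ψ = S_{2X²−3X}`,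
`Φ(t) = 2Ψ(2t)`; `…StubMellinDivide`: `d/dt e^{wt}`). No definitions. Groundwork for file XX-b
(`HandoffHardyRigidity`: the logical status of idea-3 g24's «Hardy rigidity» H-RIG, HANDOFF-STATEMENT §J.33).

THE CLASS. idea-3 §G24-3 singles out Riemann's kernel among Weil-harmonic functions by the two-sided tail
`‖v(t)‖ ≤ C (1 + e^{2|t|})^D e^{|t|/2} e^{−πe^{2|t|}}` — rate EXACTLY `π` in the double exponential, polynomial
order `D` (`Φ` itself: `D = 2`). The tree's envelopes for `Φ` (`…PhiTail.exists_norm_phi_le`,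
`LagariasMontague.exists_abs_thetaSeries_le`) keep only the rate `π/4` (the polynomial is absorbed into the
Gaussian), which is too weak to place anything in that class. This file supplies the sharp versions:

* §1 `exists_abs_thetaSeries_le_sharp`: if `|p(y)| ≤ A(1+y)^d` on `y ≥ 0` then for `u ≥ 0`
  `|S_p(u)| ≤ C (1 + πeᵘ)^d e^{u/4} e^{−πeᵘ}` — the envelope of the LEADING theta term (the terms `n ≥ 1` are
  smaller by `e^{−πn}`, `abs_thetaTerm_le_sharp`); hence (`Psi_neg` for the left tail)
  **`exists_norm_phi_le_sharp : ‖Φ(t)‖ ≤ C (1 + e^{2|t|})² e^{|t|/2 − πe^{2|t|}}`** — `Φ` is in the class, `D = 2`.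
* §2 `norm_le_gaussEnv_of_ode`: the class is STABLE UNDER MELLIN DIVISION. If `G′ = −wG − F` with `G`
  exponentially small (`‖G‖ ≤ C′e^{−b|t|}`, `b > |Re w|`, `|Re w| ≤ 1/2` — the output shape of the tree's
  `stub_mellin_divide(_strong)`, `F̂(s) = (s − s₀)Ĝ(s)`, `w = s₀ − ½`) and `F` has the order-2 rate-`π` tail,
  then so has `G`, with constant `C/(2π − 9/2 − |Re w|)`: `e^{wt}G(t) = ∫_t^∞ e^{wu}F(u) du` (FTC on `[t, ∞)`,
  `norm_le_gaussEnv_right`) and the envelope shifts under the integral with loss `e^{−(2π − 9/2 − Re w)(u−t)}`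
  (`gaussEnv_shift_le`, using `e^{2u} − e^{2t} ≥ 2(u − t)`); the left tail is the right tail of `G(−·)`.

So dividing `Φ̂ = ξ` by `(s − ρ₀)` at a zero does NOT leave the rate-`π` class — the analytic half of XX-b's
observation that H-RIG, typed over the harmonic predicate, is at least the Simple Zeros Conjecture.

References: Hardy 1933 (JLMS 8) Thm 1 via Fernández-Bertolin–Vega arXiv:2507.08370 p. 1 and
Bonami–Demange–Jaming 2003 Thm 1.1 (the degree bound) [handoff-lit §95]; idea-3 IDEAS-finite-rank PART G24
§G24-3 (H1)–(H7); Lagarias–Montague 2011 Lemma 3.1 (theta series) [cite: LagariasMontague2011, Lemma 3.1].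
-/

set_option linter.dupNamespace false  -- the mandated namespace repeats `RiemannHypothesis`

noncomputable section

open Set Filter MeasureTheory Complex
open scoped Topology Real
open Literature.NumberTheory.LFunctions
open Summit.RiemannHypothesis.RiemannHypothesis.Theorems.GroundStatesConvergeToXi (mdiv_hasDerivAt_cexp)

namespace Summit.RiemannHypothesis.RiemannHypothesis.Theorems.HandoffGaussTail

/-! ## §1 The SHARP Gaussian tail of a theta series: rate exactly `π`, polynomial order `d` -/

/-- Every real polynomial is `O((1+y)^d)` on `[0, ∞)`, `d` its degree. [folklore] -/
theorem exists_abs_eval_le_pow (p : Polynomial ℝ) :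
    ∃ A : ℝ, 0 ≤ A ∧ ∀ y : ℝ, 0 ≤ y → |p.eval y| ≤ A * (1 + y) ^ p.natDegree := by
  refine ⟨∑ i ∈ Finset.range (p.natDegree + 1), |p.coeff i|, Finset.sum_nonneg fun _ _ => abs_nonneg _,
    fun y hy => ?_⟩
  rw [Polynomial.eval_eq_sum_range, Finset.sum_mul]
  refine (Finset.abs_sum_le_sum_abs _ _).trans (Finset.sum_le_sum fun i hi => ?_)
  rw [abs_mul, abs_of_nonneg (pow_nonneg hy i)]
  refine mul_le_mul_of_nonneg_left ?_ (abs_nonneg _)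
  have hi' : i ≤ p.natDegree := Nat.lt_succ_iff.1 (Finset.mem_range.1 hi)
  calc y ^ i ≤ (1 + y) ^ i := pow_le_pow_left₀ hy (by linarith) i
    _ ≤ (1 + y) ^ p.natDegree := pow_le_pow_right₀ (by linarith) hi'

/-- `(1+z)^d e^{-z} ≤ 2^d d! e^{1/2} · e^{-z/2}` for `z ≥ 0` (from `x^d/d! ≤ eˣ` at `x = (1+z)/2`).
[folklore] -/
theorem one_add_pow_mul_exp_neg_le (d : ℕ) {z : ℝ} (hz : 0 ≤ z) :
    (1 + z) ^ d * Real.exp (-z) ≤ 2 ^ d * d.factorial * Real.exp (1 / 2) * Real.exp (-(z / 2)) := by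
  have h := Real.pow_div_factorial_le_exp (x := (1 + z) / 2) (by positivity) d
  rw [div_pow, div_le_iff₀ (by positivity)] at h
  have h2 : (1 + z) ^ d ≤ 2 ^ d * d.factorial * Real.exp ((1 + z) / 2) := by
    rw [div_le_iff₀ (by positivity)] at h
    linarith
  calc (1 + z) ^ d * Real.exp (-z) ≤ 2 ^ d * d.factorial * Real.exp ((1 + z) / 2) * Real.exp (-z) :=
        mul_le_mul_of_nonneg_right h2 (Real.exp_pos _).le
    _ = 2 ^ d * d.factorial * Real.exp (1 / 2) * Real.exp (-(z / 2)) := by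
        have he : Real.exp ((1 + z) / 2) * Real.exp (-z) = Real.exp (1 / 2) * Real.exp (-(z / 2)) := by
          rw [← Real.exp_add, ← Real.exp_add]; congr 1; ring
        rw [mul_assoc (2 ^ d * (d.factorial : ℝ)), he, ← mul_assoc]

/-- **Sharp term bound.** If `|p(y)| ≤ A (1+y)^d` on `y ≥ 0`, then for `u ≥ 0` the `n`-th theta term obeys
`|p(aₙeᵘ) e^{u/4 − aₙeᵘ}| ≤ A K_d e^{-πn} · (1 + πeᵘ)^d e^{u/4} e^{−πeᵘ}`, `K_d = 2^d d! e^{1/2}`: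
rate EXACTLY `π` in the leading Gaussian, the `n ≥ 1` terms geometrically smaller. [folklore] -/
theorem abs_thetaTerm_le_sharp {p : Polynomial ℝ} {A : ℝ} {d : ℕ} (hA : 0 ≤ A)
    (hp : ∀ y : ℝ, 0 ≤ y → |p.eval y| ≤ A * (1 + y) ^ d) (n : ℕ) {u : ℝ} (hu : 0 ≤ u) :
    |LagariasMontague.thetaTerm p n u| ≤
      A * (2 ^ d * d.factorial * Real.exp (1 / 2)) * Real.exp (-(π * n)) *
        ((1 + π * Real.exp u) ^ d * Real.exp (u / 4) * Real.exp (-(π * Real.exp u))) := by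
  -- notation: `Y = π eᵘ ≥ π`, `Z = π(n² + 2n) eᵘ ≥ π n`, `aₙ eᵘ = Y + Z`
  set Y : ℝ := π * Real.exp u with hY
  set Z : ℝ := π * ((n : ℝ) ^ 2 + 2 * n) * Real.exp u with hZ
  have hY0 : 0 ≤ Y := by positivity
  have hZ0 : 0 ≤ Z := by positivity
  have heu : 1 ≤ Real.exp u := Real.one_le_exp hu
  have hZn : π * n ≤ Z := by
    have h1 : (n : ℝ) ≤ ((n : ℝ) ^ 2 + 2 * n) * Real.exp u := by
      have hn : (0 : ℝ) ≤ n := n.cast_nonneg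
      nlinarith
    calc π * n ≤ π * (((n : ℝ) ^ 2 + 2 * n) * Real.exp u) := mul_le_mul_of_nonneg_left h1 Real.pi_pos.le
      _ = Z := by rw [hZ]; ring
  have haw : LagariasMontague.thetaWeight n * Real.exp u = Y + Z := by
    rw [LagariasMontague.thetaWeight, hY, hZ]; ring
  rw [LagariasMontague.thetaTerm, abs_mul, abs_of_pos (Real.exp_pos _), haw]
  have hpY := hp (Y + Z) (by positivity)
  -- `(1 + Y + Z)^d ≤ (1+Y)^d (1+Z)^d`
  have hsplit : (1 + (Y + Z)) ^ d ≤ (1 + Y) ^ d * (1 + Z) ^ d := by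
    rw [← mul_pow]
    exact pow_le_pow_left₀ (by positivity) (by nlinarith) d
  have hK := one_add_pow_mul_exp_neg_le d hZ0
  have hexp : Real.exp (u / 4 - (Y + Z)) = Real.exp (u / 4) * Real.exp (-Y) * Real.exp (-Z) := by
    rw [← Real.exp_add, ← Real.exp_add]; congr 1; ring
  rw [hexp]
  have hZ2 : Real.exp (-(Z / 2)) ≤ Real.exp (-(π * n)) := by
    rw [Real.exp_le_exp]
    have : π * n ≤ Z / 2 + Z / 2 := by linarith
    nlinarith [Real.pi_pos.le, (n.cast_nonneg : (0:ℝ) ≤ n)]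
  calc |p.eval (Y + Z)| * (Real.exp (u / 4) * Real.exp (-Y) * Real.exp (-Z))
      ≤ A * ((1 + Y) ^ d * (1 + Z) ^ d) * (Real.exp (u / 4) * Real.exp (-Y) * Real.exp (-Z)) := by
        refine mul_le_mul_of_nonneg_right (hpY.trans ?_) (by positivity)
        exact mul_le_mul_of_nonneg_left hsplit hA
    _ = A * ((1 + Z) ^ d * Real.exp (-Z)) * ((1 + Y) ^ d * Real.exp (u / 4) * Real.exp (-Y)) := by
        ring
    _ ≤ A * (2 ^ d * d.factorial * Real.exp (1 / 2) * Real.exp (-(Z / 2))) *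
          ((1 + Y) ^ d * Real.exp (u / 4) * Real.exp (-Y)) := by
        gcongr
    _ ≤ A * (2 ^ d * d.factorial * Real.exp (1 / 2) * Real.exp (-(π * n))) *
          ((1 + Y) ^ d * Real.exp (u / 4) * Real.exp (-Y)) := by
        gcongr
    _ = _ := by rw [hY]; ring

/-- **Sharp theta tail (rate exactly `π`).** If `|p(y)| ≤ A(1+y)^d` on `y ≥ 0` then, for `u ≥ 0`,
`|S_p(u)| ≤ C (1 + πeᵘ)^d e^{u/4} e^{−πeᵘ}` — the envelope of the leading term `p(πeᵘ)e^{u/4−πeᵘ}` itself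
(the tree's `exists_abs_thetaSeries_le` keeps only the rate `π/4`). [folklore] -/
theorem exists_abs_thetaSeries_le_sharp {p : Polynomial ℝ} {A : ℝ} {d : ℕ} (hA : 0 ≤ A)
    (hp : ∀ y : ℝ, 0 ≤ y → |p.eval y| ≤ A * (1 + y) ^ d) :
    ∃ C : ℝ, 0 ≤ C ∧ ∀ u : ℝ, 0 ≤ u → |LagariasMontague.thetaSeries p u| ≤
      C * ((1 + π * Real.exp u) ^ d * Real.exp (u / 4) * Real.exp (-(π * Real.exp u))) := by
  have hgeo : Summable fun n : ℕ => Real.exp (-(π * n)) := by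
    have h := Real.summable_exp_nat_mul_iff.2 (neg_lt_zero.2 Real.pi_pos)
    refine h.congr fun n => ?_
    ring_nf
  set K : ℝ := A * (2 ^ d * d.factorial * Real.exp (1 / 2)) with hK
  refine ⟨K * ∑' n : ℕ, Real.exp (-(π * n)), by positivity, fun u hu => ?_⟩
  have hb : ∀ n : ℕ, ‖LagariasMontague.thetaTerm p n u‖ ≤
      K * Real.exp (-(π * n)) *
        ((1 + π * Real.exp u) ^ d * Real.exp (u / 4) * Real.exp (-(π * Real.exp u))) := fun n => by
    rw [Real.norm_eq_abs, hK]
    exact abs_thetaTerm_le_sharp hA hp n hu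
  have h := tsum_of_norm_bounded ((hgeo.hasSum.mul_left K).mul_right _) hb
  rw [Real.norm_eq_abs] at h
  simpa [LagariasMontague.thetaSeries, mul_assoc] using h

/-- `|2y² − 3y| ≤ 3(1+y)²` on `y ≥ 0`: Riemann's polynomial `psiPoly = 2X² − 3X` has order `d = 2`.
[folklore] -/
theorem abs_eval_psiPoly_le (y : ℝ) (hy : 0 ≤ y) :
    |LagariasMontague.psiPoly.eval y| ≤ 3 * (1 + y) ^ 2 := by
  have h : LagariasMontague.psiPoly.eval y = 2 * y ^ 2 - 3 * y := by
    simp [LagariasMontague.psiPoly]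
  rw [h, abs_le]
  constructor <;> nlinarith

/-- **The sharp two-sided Gaussian tail of Riemann's kernel**: `‖Φ(t)‖ ≤ C (1 + e^{2|t|})² e^{|t|/2} e^{−πe^{2|t|}}`
for `Φ(t) = 2Ψ(2t)` — rate EXACTLY `π`, order `2` (idea-3 §G24-3's class of `Φ`; the tree's `exists_norm_phi_le`
has rate `π/4`). Evenness of `Ψ` (`Psi_neg`, the theta functional equation) supplies the left tail. [folklore] -/
theorem exists_norm_phi_le_sharp :
    ∃ C : ℝ, 0 ≤ C ∧ ∀ t : ℝ, ‖(2 : ℂ) * LagariasMontague.Psic (2 * t)‖ ≤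
      C * (1 + Real.exp (2 * |t|)) ^ 2 * Real.exp (|t| / 2 - π * Real.exp (2 * |t|)) := by
  obtain ⟨C, hC, hb⟩ := exists_abs_thetaSeries_le_sharp (d := 2) (by norm_num : (0:ℝ) ≤ 3)
    abs_eval_psiPoly_le
  refine ⟨2 * C * π ^ 2, by positivity, fun t => ?_⟩
  have key : ‖(2 : ℂ) * LagariasMontague.Psic (2 * t)‖ = 2 * |LagariasMontague.Psi (2 * |t|)| := by
    rw [norm_mul, LagariasMontague.Psic, Complex.norm_real, Real.norm_eq_abs]
    rcases le_or_gt 0 t with ht | ht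
    · rw [abs_of_nonneg ht]; norm_num
    · rw [abs_of_neg ht, show 2 * -t = -(2 * t) by ring, LagariasMontague.Psi_neg]; norm_num
  rw [key]
  have h1 := hb (2 * |t|) (by positivity)
  have hπ : (1 + π * Real.exp (2 * |t|)) ^ 2 ≤ π ^ 2 * (1 + Real.exp (2 * |t|)) ^ 2 := by
    rw [← mul_pow]
    refine pow_le_pow_left₀ (by positivity) ?_ 2
    nlinarith [Real.pi_gt_three, Real.exp_pos (2 * |t|)]
  have h2 : Real.exp (2 * |t| / 4) = Real.exp (|t| / 2) := by congr 1; ring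
  unfold LagariasMontague.Psi at h1 ⊢
  calc 2 * |LagariasMontague.thetaSeries LagariasMontague.psiPoly (2 * |t|)|
      ≤ 2 * (C * ((1 + π * Real.exp (2 * |t|)) ^ 2 * Real.exp (2 * |t| / 4) *
          Real.exp (-(π * Real.exp (2 * |t|))))) := by gcongr
    _ ≤ 2 * (C * ((π ^ 2 * (1 + Real.exp (2 * |t|)) ^ 2) * Real.exp (2 * |t| / 4) *
          Real.exp (-(π * Real.exp (2 * |t|))))) := by gcongr
    _ = 2 * C * π ^ 2 * (1 + Real.exp (2 * |t|)) ^ 2 * Real.exp (|t| / 2 - π * Real.exp (2 * |t|)) := by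
        rw [h2, Real.exp_sub]; rw [Real.exp_neg]; ring

/-! ## §2 Dividing the Mellin transform by a zero PRESERVES the Gaussian tail

If `G' = −wG − F` with `G` exponentially small (`‖G‖ ≤ C'e^{−b|t|}`, `b > |Re w|`) — the shape of the
tree's `stub_mellin_divide(_strong)` — then `e^{wt}G(t) = ∫_t^∞ e^{wu}F(u) du`, and the order-2 rate-`π`
envelope of `F` passes to `G` (for `|Re w| ≤ 1/2`; the loss exponent `2π − 9/2 − Re w > 0`). -/

/-- Shifting the envelope: for `t, s ≥ 0` and any real `a`,
`(1+e^{2(t+s)})² e^{(t+s)/2 − πe^{2(t+s)}} e^{a(t+s)} ≤ (1+e^{2t})² e^{t/2 − πe^{2t}} e^{at} · e^{(9/2 + a − 2π)s}`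
(uses `e^{2(t+s)} − e^{2t} ≥ 2s`). [folklore] -/
theorem gaussEnv_shift_le {t s : ℝ} (ht : 0 ≤ t) (hs : 0 ≤ s) (a : ℝ) :
    (1 + Real.exp (2 * (t + s))) ^ 2 * Real.exp ((t + s) / 2 - π * Real.exp (2 * (t + s))) *
        Real.exp (a * (t + s)) ≤
      (1 + Real.exp (2 * t)) ^ 2 * Real.exp (t / 2 - π * Real.exp (2 * t)) * Real.exp (a * t) *
        Real.exp ((9 / 2 + a - 2 * π) * s) := by
  have h2s : 1 ≤ Real.exp (2 * s) := Real.one_le_exp (by linarith)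
  have h2t : 1 ≤ Real.exp (2 * t) := Real.one_le_exp (by linarith)
  have hsum : Real.exp (2 * (t + s)) = Real.exp (2 * t) * Real.exp (2 * s) := by
    rw [← Real.exp_add]; congr 1; ring
  -- `1 + e^{2(t+s)} ≤ (1 + e^{2t}) e^{2s}`
  have h1 : 1 + Real.exp (2 * (t + s)) ≤ (1 + Real.exp (2 * t)) * Real.exp (2 * s) := by
    rw [hsum]; nlinarith [Real.exp_pos (2 * t)]
  have h1sq : (1 + Real.exp (2 * (t + s))) ^ 2 ≤ (1 + Real.exp (2 * t)) ^ 2 * Real.exp (4 * s) := by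
    have h4 : Real.exp (4 * s) = Real.exp (2 * s) ^ 2 := by
      rw [← Real.exp_nat_mul]; congr 1; ring
    rw [h4, ← mul_pow]
    exact pow_le_pow_left₀ (by positivity) h1 2
  -- `π e^{2(t+s)} ≥ π e^{2t} + 2π s`
  have hgauss : π * Real.exp (2 * t) + 2 * π * s ≤ π * Real.exp (2 * (t + s)) := by
    rw [hsum]
    have h3 : 1 + 2 * s ≤ Real.exp (2 * s) := by linarith [Real.add_one_le_exp (2 * s)]
    have h4 : Real.exp (2 * t) * (1 + 2 * s) ≤ Real.exp (2 * t) * Real.exp (2 * s) :=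
      mul_le_mul_of_nonneg_left h3 (Real.exp_pos _).le
    have h5 : π * (Real.exp (2 * t) * (1 + 2 * s)) ≤ π * (Real.exp (2 * t) * Real.exp (2 * s)) :=
      mul_le_mul_of_nonneg_left h4 Real.pi_pos.le
    have h6 : 2 * π * s ≤ 2 * π * s * Real.exp (2 * t) := le_mul_of_one_le_right (by positivity) h2t
    calc π * Real.exp (2 * t) + 2 * π * s ≤ π * Real.exp (2 * t) + 2 * π * s * Real.exp (2 * t) := by
          linarith
      _ = π * (Real.exp (2 * t) * (1 + 2 * s)) := by ring
      _ ≤ π * (Real.exp (2 * t) * Real.exp (2 * s)) := h5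
  have hexp : Real.exp ((t + s) / 2 - π * Real.exp (2 * (t + s))) * Real.exp (a * (t + s)) ≤
      Real.exp (t / 2 - π * Real.exp (2 * t)) * Real.exp (a * t) * Real.exp ((1 / 2 + a - 2 * π) * s) := by
    rw [← Real.exp_add, ← Real.exp_add, ← Real.exp_add, Real.exp_le_exp]
    nlinarith
  calc (1 + Real.exp (2 * (t + s))) ^ 2 * Real.exp ((t + s) / 2 - π * Real.exp (2 * (t + s))) *
        Real.exp (a * (t + s))
      = (1 + Real.exp (2 * (t + s))) ^ 2 * (Real.exp ((t + s) / 2 - π * Real.exp (2 * (t + s))) *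
        Real.exp (a * (t + s))) := by ring
    _ ≤ (1 + Real.exp (2 * t)) ^ 2 * Real.exp (4 * s) *
        (Real.exp (t / 2 - π * Real.exp (2 * t)) * Real.exp (a * t) * Real.exp ((1 / 2 + a - 2 * π) * s)) :=
        mul_le_mul h1sq hexp (by positivity) (by positivity)
    _ = (1 + Real.exp (2 * t)) ^ 2 * Real.exp (t / 2 - π * Real.exp (2 * t)) * Real.exp (a * t) *
        (Real.exp (4 * s) * Real.exp ((1 / 2 + a - 2 * π) * s)) := by ring
    _ = _ := by rw [← Real.exp_add]; congr 2; ring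

/-- **Right tail.** If `G' = −wG − F`, `‖G(t)‖ ≤ C' e^{−b|t|}` with `Re w < b`, `Re w ≤ 1/2`, and `F` is
continuous with `‖F(t)‖ ≤ C(1+e^{2|t|})² e^{|t|/2 − πe^{2|t|}}`, then for `t ≥ 0`
`‖G(t)‖ ≤ C/(2π − 9/2 − Re w) · (1+e^{2t})² e^{t/2 − πe^{2t}}`: write `e^{wt}G(t) = ∫_t^∞ e^{wu}F(u) du`
(FTC on `[t, ∞)`, `e^{wu}G(u) → 0`) and shift the envelope under the integral. [folklore] -/
theorem norm_le_gaussEnv_right {F G : ℝ → ℂ} {w : ℂ} {C C' b : ℝ} (hFc : Continuous F)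
    (hF : ∀ t, ‖F t‖ ≤ C * (1 + Real.exp (2 * |t|)) ^ 2 * Real.exp (|t| / 2 - π * Real.exp (2 * |t|)))
    (hG : ∀ t, HasDerivAt G (-w * G t - F t) t) (hGb : ∀ t, ‖G t‖ ≤ C' * Real.exp (-(b * |t|)))
    (hwb : w.re < b) (hw : w.re ≤ 1 / 2) {t : ℝ} (ht : 0 ≤ t) :
    ‖G t‖ ≤ C / (2 * π - 9 / 2 - w.re) *
      ((1 + Real.exp (2 * t)) ^ 2 * Real.exp (t / 2 - π * Real.exp (2 * t))) := by
  have hC : 0 ≤ C := by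
    have h := (norm_nonneg _).trans (hF 0)
    have h' : 0 < (1 + Real.exp (2 * |(0:ℝ)|)) ^ 2 * Real.exp (|(0:ℝ)| / 2 - π * Real.exp (2 * |(0:ℝ)|)) := by
      positivity
    nlinarith
  set κ : ℝ := 2 * π - 9 / 2 - w.re with hκ
  have hκ0 : 0 < κ := by rw [hκ]; nlinarith [Real.pi_gt_three]
  -- `H(u) = e^{wu} G(u)`, `H' = -e^{wu} F(u)`
  set H : ℝ → ℂ := fun u => cexp (w * u) * G u with hH
  have hHd : ∀ u : ℝ, HasDerivAt H (-(cexp (w * (u : ℂ)) * F u)) u := by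
    intro u
    have h := (mdiv_hasDerivAt_cexp w u).mul (hG u)
    refine h.congr_deriv ?_
    ring
  have hnormH : ∀ u, ‖H u‖ = Real.exp (w.re * u) * ‖G u‖ := fun u => by
    rw [hH]; dsimp only
    rw [norm_mul, Complex.norm_exp, show (w * (u : ℂ)).re = w.re * u by simp [mul_re]]
  -- `H → 0` at `+∞`
  have hHlim : Tendsto H atTop (𝓝 0) := by
    rw [tendsto_zero_iff_norm_tendsto_zero]
    have hC' : 0 ≤ C' := by
      have := (norm_nonneg _).trans (hGb 0); simpa using this
    have hlim : Tendsto (fun u : ℝ => C' * Real.exp ((w.re - b) * u)) atTop (𝓝 (C' * 0)) :=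
      tendsto_const_nhds.mul (Real.tendsto_exp_atBot.comp
        (tendsto_id.const_mul_atTop_of_neg (by linarith)))
    rw [mul_zero] at hlim
    refine squeeze_zero_norm' ?_ hlim
    filter_upwards [eventually_ge_atTop 0] with u hu
    rw [norm_norm, hnormH]
    calc Real.exp (w.re * u) * ‖G u‖ ≤ Real.exp (w.re * u) * (C' * Real.exp (-(b * |u|))) :=
          mul_le_mul_of_nonneg_left (hGb u) (Real.exp_pos _).le
      _ = C' * Real.exp ((w.re - b) * u) := by
          rw [abs_of_nonneg hu, mul_left_comm, ← Real.exp_add]; congr 2; ring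
  -- the shifted envelope dominates the integrand on `(t, ∞)`
  set B : ℝ := C * ((1 + Real.exp (2 * t)) ^ 2 * Real.exp (t / 2 - π * Real.exp (2 * t))) *
    Real.exp (w.re * t) with hB
  have hdom : ∀ u : ℝ, t < u → ‖-(cexp (w * (u : ℂ)) * F u)‖ ≤ B * Real.exp (κ * t) * Real.exp (-κ * u) := by
    intro u hu
    have hu0 : 0 ≤ u := ht.trans hu.le
    obtain ⟨s, hs, rfl⟩ : ∃ s, 0 ≤ s ∧ u = t + s := ⟨u - t, by linarith, by ring⟩
    rw [norm_neg, norm_mul, Complex.norm_exp, show (w * ((t + s : ℝ) : ℂ)).re = w.re * (t + s) by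
      simp [mul_re]]
    have hF' := hF (t + s)
    rw [abs_of_nonneg hu0] at hF'
    have key := gaussEnv_shift_le ht hs w.re
    calc Real.exp (w.re * (t + s)) * ‖F (t + s)‖
        ≤ Real.exp (w.re * (t + s)) * (C * (1 + Real.exp (2 * (t + s))) ^ 2 *
            Real.exp ((t + s) / 2 - π * Real.exp (2 * (t + s)))) :=
          mul_le_mul_of_nonneg_left hF' (Real.exp_pos _).le
      _ = C * ((1 + Real.exp (2 * (t + s))) ^ 2 * Real.exp ((t + s) / 2 - π * Real.exp (2 * (t + s))) *
            Real.exp (w.re * (t + s))) := by ring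
      _ ≤ C * ((1 + Real.exp (2 * t)) ^ 2 * Real.exp (t / 2 - π * Real.exp (2 * t)) * Real.exp (w.re * t) *
            Real.exp ((9 / 2 + w.re - 2 * π) * s)) := mul_le_mul_of_nonneg_left key hC
      _ = B * Real.exp (κ * t) * Real.exp (-κ * (t + s)) := by
          have hks : Real.exp (κ * t) * Real.exp (-κ * (t + s)) =
              Real.exp ((9 / 2 + w.re - 2 * π) * s) := by
            rw [← Real.exp_add]; congr 1; rw [hκ]; ring
          rw [mul_assoc B, hks, hB]; ring
  have hint_bound : IntegrableOn (fun u : ℝ => B * Real.exp (κ * t) * Real.exp (-κ * u)) (Ioi t) :=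
    ((exp_neg_integrableOn_Ioi t hκ0).const_mul _)
  have hmeas : AEStronglyMeasurable (fun u : ℝ => -(cexp (w * u) * F u)) (volume.restrict (Ioi t)) :=
    ((by fun_prop : Continuous fun u : ℝ => -(cexp (w * u) * F u))).aestronglyMeasurable
  have hint : IntegrableOn (fun u : ℝ => -(cexp (w * u) * F u)) (Ioi t) :=
    hint_bound.mono' hmeas (ae_restrict_of_forall_mem measurableSet_Ioi fun u hu => hdom u hu)
  -- FTC on `[t, ∞)`: `∫_t^∞ H' = 0 - H(t)`
  have hFTC := integral_Ioi_of_hasDerivAt_of_tendsto' (fun u _ => hHd u) hint hHlim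
  have hHt : ‖H t‖ ≤ B * Real.exp (κ * t) * (Real.exp (-κ * t) / κ) := by
    have h1 : ‖∫ u in Ioi t, -(cexp (w * u) * F u)‖ ≤ ∫ u in Ioi t, B * Real.exp (κ * t) * Real.exp (-κ * u) :=
      norm_integral_le_of_norm_le hint_bound
        (ae_restrict_of_forall_mem measurableSet_Ioi fun u hu => hdom u hu)
    rw [hFTC, zero_sub, norm_neg] at h1
    rw [integral_const_mul, integral_exp_mul_Ioi (by linarith) t] at h1
    convert h1 using 2
    field_simp
  -- unwind `‖G t‖ = e^{-Re w t} ‖H t‖`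
  have hGt : ‖G t‖ = Real.exp (-(w.re * t)) * ‖H t‖ := by
    rw [hnormH, ← mul_assoc, ← Real.exp_add, neg_add_cancel, Real.exp_zero, one_mul]
  rw [hGt]
  calc Real.exp (-(w.re * t)) * ‖H t‖ ≤ Real.exp (-(w.re * t)) * (B * Real.exp (κ * t) * (Real.exp (-κ * t) / κ)) :=
        mul_le_mul_of_nonneg_left hHt (Real.exp_pos _).le
    _ = C / κ * ((1 + Real.exp (2 * t)) ^ 2 * Real.exp (t / 2 - π * Real.exp (2 * t))) *
        (Real.exp (-(w.re * t)) * Real.exp (w.re * t)) * (Real.exp (κ * t) * Real.exp (-κ * t)) := by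
        rw [hB]; field_simp
    _ = C / κ * ((1 + Real.exp (2 * t)) ^ 2 * Real.exp (t / 2 - π * Real.exp (2 * t))) := by
        rw [← Real.exp_add, ← Real.exp_add, neg_add_cancel, show κ * t + -κ * t = 0 by ring,
          Real.exp_zero, mul_one, mul_one]

/-- **Two-sided Gaussian tail of the quotient.** Same hypotheses with `|Re w| < b`, `|Re w| ≤ 1/2`; then
`‖G(t)‖ ≤ C/(2π − 9/2 − |Re w|) · (1+e^{2|t|})² e^{|t|/2 − πe^{2|t|}}` for every `t` (the left tail is the
right tail of `t ↦ G(−t)`, which solves the same equation with `w ↦ −w`, `F ↦ −F(−·)`). [folklore] -/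
theorem norm_le_gaussEnv_of_ode {F G : ℝ → ℂ} {w : ℂ} {C C' b : ℝ} (hFc : Continuous F)
    (hF : ∀ t, ‖F t‖ ≤ C * (1 + Real.exp (2 * |t|)) ^ 2 * Real.exp (|t| / 2 - π * Real.exp (2 * |t|)))
    (hG : ∀ t, HasDerivAt G (-w * G t - F t) t) (hGb : ∀ t, ‖G t‖ ≤ C' * Real.exp (-(b * |t|)))
    (hwb : |w.re| < b) (hw : |w.re| ≤ 1 / 2) (t : ℝ) :
    ‖G t‖ ≤ C / (2 * π - 9 / 2 - |w.re|) *
      ((1 + Real.exp (2 * |t|)) ^ 2 * Real.exp (|t| / 2 - π * Real.exp (2 * |t|))) := by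
  have hC : 0 ≤ C := by
    have h := (norm_nonneg _).trans (hF 0)
    have h' : 0 < (1 + Real.exp (2 * |(0:ℝ)|)) ^ 2 * Real.exp (|(0:ℝ)| / 2 - π * Real.exp (2 * |(0:ℝ)|)) := by
      positivity
    nlinarith
  have hκ : 0 < 2 * π - 9 / 2 - |w.re| := by nlinarith [Real.pi_gt_three]
  have hmono : ∀ r : ℝ, r ≤ |w.re| → C / (2 * π - 9 / 2 - r) ≤ C / (2 * π - 9 / 2 - |w.re|) := fun r hr =>
    div_le_div_of_nonneg_left hC hκ (by linarith)
  rcases le_or_gt 0 t with ht | ht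
  · have h := norm_le_gaussEnv_right hFc hF hG hGb (lt_of_le_of_lt (le_abs_self _) hwb)
      ((le_abs_self _).trans hw) ht
    rw [abs_of_nonneg ht]
    exact h.trans (mul_le_mul_of_nonneg_right (hmono _ (le_abs_self _)) (by positivity))
  · -- reflect
    have hG' : ∀ u, HasDerivAt (fun u => G (-u)) (-(-w) * G (-u) - (-F (-u))) u := by
      intro u
      have h := (hG (-u)).scomp u (hasDerivAt_neg u)
      refine h.congr_deriv ?_
      rw [neg_one_smul]
      ring
    have hF' : ∀ u, ‖-F (-u)‖ ≤ C * (1 + Real.exp (2 * |u|)) ^ 2 * Real.exp (|u| / 2 - π * Real.exp (2 * |u|)) :=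
      fun u => by rw [norm_neg]; simpa only [abs_neg] using hF (-u)
    have hGb' : ∀ u, ‖G (-u)‖ ≤ C' * Real.exp (-(b * |u|)) := fun u => by simpa only [abs_neg] using hGb (-u)
    have hFc' : Continuous fun u => -F (-u) := (hFc.comp continuous_neg).neg
    have hwre : (-w).re = -w.re := by simp
    have h := norm_le_gaussEnv_right (G := fun u => G (-u)) hFc' hF' hG' hGb'
      (by rw [hwre]; linarith [neg_abs_le w.re]) (by rw [hwre]; linarith [neg_abs_le w.re])
      (by linarith : 0 ≤ -t)
    rw [neg_neg, hwre, sub_neg_eq_add] at h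
    rw [abs_of_neg ht]
    refine h.trans (mul_le_mul_of_nonneg_right ?_ (by positivity))
    have := hmono (-w.re) (neg_le_abs _)
    rwa [sub_neg_eq_add] at this

end Summit.RiemannHypothesis.RiemannHypothesis.Theorems.HandoffGaussTail

end
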